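import Mathlib
import HarnessLib
import Literature.MathematicalPhysics.StatisticalMechanics.RenormalisationMapExpansion
import Literature.MathematicalPhysics.StatisticalMechanics.RenormalisationMapZero

/-!
# The outer split of the reblocked renormalisation map: `X₁ = ∅`, `X₁ = X`, and the rest ([ABKM19] Ch. 9.1)

`GradientRG.nextKStep_eq_sum` writes `K_{k+1}(U) = S(H,K)(U)` as
`Σ_{π(X)=U} Σ_{X₁ ∈ 𝓟_k(X)} (e^{−H̃})^{U∖X}(e^{H̃})^{X∖U}(1−e^{−H̃})^{X₁}·R[P₂(e^{−H},K)(X∖X₁)]`.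
For the first-order analysis of `S` (the crux line's `IsRGStepQ.lipschitz`; [ABKM19] Thm 6.7 at first
order) the inner sum is split at its two extreme terms: `X₁ = ∅` (factor `R[P₂(X)]`, which contains the
linear pieces `R K(X)` and `R(e^{−H}−1)^X`, see `PolymerProductSplit.polyP2_eq_add_add_rest`) and `X₁ = X`
(factor `(1−e^{−H̃})^X · R[P₂(∅)] = (1−e^{−H̃})^X`); every other `X₁` gives a term of degree `≥ 2`.

* `polys_empty`, `polyP2_empty` — `𝓟_k(∅) = {∅}`, `P₂(∅) = 1` (for `K(∅) = 1`);
* **`nextKStep_eq_split`** — for `U ≠ ∅`: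
  `S(H,K)(U,φ) = Σ_{π(X)=U} (e^{−H̃})^{U∖X}(e^{H̃})^{X∖U}·(R[P₂(X)](φ) + (1−e^{−H̃})^{X}(φ))
               + Σ_{π(X)=U} Σ_{∅≠X₁⊊X} (e^{−H̃})^{U∖X}(e^{H̃})^{X∖U}(1−e^{−H̃})^{X₁}R[P₂(X∖X₁)](φ)`.

Everything is proved; no named fact.

## References
* S. Adams, S. Buchholz, R. Kotecký, S. Müller, arXiv:1910.13564, Ch. 9.1 (the decomposition of `S`),
  proof of Theorem 6.7 / Lemma 9.6 [AdamsBuchholzKoteckyMuller2019].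
-/

noncomputable section

namespace Literature.MathematicalPhysics.StatisticalMechanics.GradientRG

open scoped BigOperators Classical
open Finset MeasureTheory
open Literature.MathematicalPhysics.StatisticalMechanics.TorusPolymer
  (IsPolymer blocks polys bprod reblock mem_polys isPolymer_empty)

variable {d M : ℕ} [NeZero M]

/-- `𝓟_k(∅) = {∅}`. [cite: AdamsBuchholzKoteckyMuller2019, Ch. 6.2] -/
theorem polys_empty (s : ℕ) : polys s (∅ : Finset (Fin d → ZMod M)) = {∅} := by
  ext Y
  rw [mem_polys, mem_singleton]
  constructor
  · rintro ⟨h, -⟩; exact subset_empty.1 h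
  · rintro rfl; exact ⟨Subset.rfl, isPolymer_empty s⟩

/-- `P₂(e^{−H},K)(∅) = 1` when `K(∅) = 1`. [cite: AdamsBuchholzKoteckyMuller2019, Ch. 9.1] -/
theorem polyP2_empty (s : ℕ) (H : RelevantHamiltonian ℂ d)
    {K : Finset (Fin d → ZMod M) → ((Fin d → ZMod M) → ℝ) → ℂ} (hK0 : ∀ φ, K ∅ φ = 1) :
    polyP2 s H K ∅ = fun _ => 1 := by
  funext ψ
  unfold polyP2
  rw [polys_empty, sum_singleton, Finset.sdiff_self, TorusPolymer.bprod_empty, hK0, one_mul]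

/-- **The outer split of `S(H,K)(U)`** (`U ≠ ∅`, with `H̃ = nextH D H K` and the integrability hypothesis
of `nextKStep_eq_sum`):
`K_{k+1}(U,φ) = Σ_{π(X)=U} (e^{−H̃})^{U∖X}(e^{H̃})^{X∖U}·(R[P₂(X)](φ) + (1−e^{−H̃})^{X}(φ))
  + Σ_{π(X)=U} Σ_{X₁ ∈ 𝓟_k(X)∖{X,∅}} (e^{−H̃})^{U∖X}(e^{H̃})^{X∖U}((1−e^{−H̃})^{X₁}·R[P₂(X∖X₁)](φ))`.
[cite: AdamsBuchholzKoteckyMuller2019, Ch. 9.1 (S = P₁(E(−R₂), E(R₂), 1 − E(−R₂), R₁P₃P₂))] -/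
theorem nextKStep_eq_split (D : StepData d M) (H : RelevantHamiltonian ℂ d)
    (K : Finset (Fin d → ZMod M) → ((Fin d → ZMod M) → ℝ) → ℂ) (hK0 : ∀ φ, K ∅ φ = 1)
    {U : Finset (Fin d → ZMod M)} (hU : U.Nonempty) (φ : (Fin d → ZMod M) → ℝ)
    (hint : ∀ Z, IsPolymer D.s Z → Integrable (fun ξ => polyP2 D.s H K Z (φ + ξ)) (stepMeasure D.𝒞)) :
    nextKStep D H K U φ =
      (∑ X ∈ (polys D.s univ).filter (fun X => reblock D.s (D.L * D.s) X = U),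
        bprod D.s (fun B => expNegH (nextH D H K) B φ) (U \ X) *
          bprod D.s (fun B => expNegH (-(nextH D H K)) B φ) (X \ U) *
          (fluct D.𝒞 (polyP2 D.s H K X) φ + bprod D.s (fun B => 1 - expNegH (nextH D H K) B φ) X)) +
      ∑ X ∈ (polys D.s univ).filter (fun X => reblock D.s (D.L * D.s) X = U),
        ∑ X₁ ∈ ((polys D.s X).erase X).erase ∅,
          bprod D.s (fun B => expNegH (nextH D H K) B φ) (U \ X) *
            bprod D.s (fun B => expNegH (-(nextH D H K)) B φ) (X \ U) *
            (bprod D.s (fun B => 1 - expNegH (nextH D H K) B φ) X₁ *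
              fluct D.𝒞 (polyP2 D.s H K (X \ X₁)) φ) := by
  rw [nextKStep_eq_sum D H K U φ hint, ← sum_add_distrib]
  refine sum_congr rfl fun X hX => ?_
  obtain ⟨hXp, hXU⟩ := mem_filter.1 hX
  have hXpoly : IsPolymer D.s X := (mem_polys.1 hXp).2
  have hXne : X.Nonempty := by
    rw [nonempty_iff_ne_empty]
    intro h
    rw [h, TorusPolymer.reblock_empty] at hXU
    exact hU.ne_empty hXU.symm
  -- split the inner sum at `X₁ = X` and `X₁ = ∅`
  have hXm : X ∈ polys D.s X := TorusPolymer.self_mem_polys hXpoly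
  have h0m : (∅ : Finset (Fin d → ZMod M)) ∈ (polys D.s X).erase X :=
    mem_erase.2 ⟨fun h => hXne.ne_empty h.symm, TorusPolymer.empty_mem_polys D.s X⟩
  rw [← add_sum_erase _ _ hXm, ← add_sum_erase _ _ h0m]
  -- the two extreme terms
  rw [Finset.sdiff_self, polyP2_empty D.s H hK0, fluct_const, sdiff_empty, TorusPolymer.bprod_empty]
  ring

end Literature.MathematicalPhysics.StatisticalMechanics.GradientRG

end
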